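import Summits.Ventures.PercRepro.C041TriangleAnsatz
import Summits.Ventures.PercRepro.C041TriangleLeafStar2

/-!
# THE SQUARE CRITERION, THE ATOM CRITERION, AND THE K₂⁺-TRANSFER OF THE LEAF MAP (mine-3, gen 67; C-041.md §21 (bd))

Three Lean forms of the structure found in the census of the pure-star hypothesis `H` (gen 67): every instance
`θ_△(V a, V b)` tested lies in the degree-two sub-cone `K₂ = cone{1, v s, v s * v t}`, and for two stars with at most
four leaves in the ONE-parameter family `θ = λ₀ • 1 + x + y * y` with `x, y` leaf mixtures (`leafMix`, the single-leaf
Lorentz cone).  **`InCone_of_square`** (THE SQUARE CRITERION): eight numbers `λ₀; t₁, t₂, σ; Q; u₁, u₂, τ` with the two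
Cauchy–Schwarz conditions `σ² ≤ t₁ t₂`, `τ² ≤ u₁ u₂` and the six coordinate equations put `θ` in the cone — the square
`Q • (y * y)` with `y = leafMix u₁ u₂ τ` carries exactly the valid type states `V₁ θ = 2 Q u₁ (u₁ + u₂ + τ)`,
`V₂ θ = 2 Q u₂ (u₁ + u₂ + τ)`, which no leaf mixture has.  **`InCone_atoms`** (THE ATOM CRITERION): a non-negative
combination of `1`, single leaves and two-leaf products at atoms in `[0, 1]` is a cone element — the shape of the
rational certificates at the decomposition atoms `a* = T₁/(σ + T₁)`, `b* = σ/(σ + T₂)` of the product star.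
**`InCone_thetaTri_leaf_K2plus`** (THE K₂⁺-TRANSFER): the leaf map `w′ ↦ θ_△(v c, w′)` carries the explicit cone
`K₂⁺ = cone{1, v s, v s * v t, X(p, q)}` into the cone, by bilinearity from THEOREM (LEAF × TWO-LEAF STAR)
(`InCone_thetaTri_leaf_star2`), the leaf × leaf theorem (`thetaTri_v_InCone`) and the marked-vertex theorem
(`InCone_thetaTri_any_marks'`); hence `H` at `(v c, V b)` for every star `V b ∈ K₂⁺` (`InCone_thetaTri_leaf_of_K2plus`).
Not every star is in `K₂⁺` (gen 67 census: about half of the three-leaf stars are not), so this is a transfer, not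
the `(1, m)` family.
-/

namespace PercRepro

namespace RelaxedTriangle

open TreeClosure Finset

/-! ## The square criterion -/

/-- **THE SQUARE IDENTITY**: the six coordinate equations force
`θ = λ₀ • 1 + leafMix t₁ t₂ σ + Q • (leafMix u₁ u₂ τ * leafMix u₁ u₂ τ)`. -/
theorem square_eq (θ : Vec6) {l0 t1 t2 σ Q u1 u2 τ : ℝ}
    (h0 : θ 0 = l0 + t1 + t2 + 2 * σ + Q * (u1 + u2 + 2 * τ) ^ 2)
    (h1 : θ 1 = l0 + 2 * t1 + t2 + 2 * σ + Q * (2 * u1 + u2 + 2 * τ) ^ 2)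
    (h2 : θ 2 = l0 + t1 + 2 * t2 + 2 * σ + Q * (u1 + 2 * u2 + 2 * τ) ^ 2)
    (h3 : θ 3 = l0 + σ + Q * τ ^ 2)
    (h4 : θ 4 = l0 + t1 + σ + Q * (u1 + τ) ^ 2)
    (h5 : θ 5 = l0 + t2 + σ + Q * (u2 + τ) ^ 2) :
    θ = l0 • (1 : Vec6) + leafMix t1 t2 σ + Q • (leafMix u1 u2 τ * leafMix u1 u2 τ) := by
  ext i
  simp only [leafMix, Pi.add_apply, Pi.smul_apply, Pi.mul_apply, Pi.one_apply, smul_eq_mul]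
  fin_cases i
  · simp [e123, v]; rw [h0]; ring
  · simp [e123, v]; rw [h1]; ring
  · simp [e123, v]; rw [h2]; ring
  · simp [e123, v]; rw [h3]; ring
  · simp [e123, v]; rw [h4]; ring
  · simp [e123, v]; rw [h5]; ring

/-- **THE SQUARE CRITERION**: a leaf mixture plus the square of a leaf mixture (and a constant) is a cone element. -/
theorem InCone_of_square (θ : Vec6) {l0 t1 t2 σ Q u1 u2 τ : ℝ}
    (hl0 : 0 ≤ l0) (ht1 : 0 ≤ t1) (ht2 : 0 ≤ t2) (hσ : 0 ≤ σ) (cs : σ ^ 2 ≤ t1 * t2)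
    (hQ : 0 ≤ Q) (hu1 : 0 ≤ u1) (hu2 : 0 ≤ u2) (hτ : 0 ≤ τ) (cs' : τ ^ 2 ≤ u1 * u2)
    (h0 : θ 0 = l0 + t1 + t2 + 2 * σ + Q * (u1 + u2 + 2 * τ) ^ 2)
    (h1 : θ 1 = l0 + 2 * t1 + t2 + 2 * σ + Q * (2 * u1 + u2 + 2 * τ) ^ 2)
    (h2 : θ 2 = l0 + t1 + 2 * t2 + 2 * σ + Q * (u1 + 2 * u2 + 2 * τ) ^ 2)
    (h3 : θ 3 = l0 + σ + Q * τ ^ 2)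
    (h4 : θ 4 = l0 + t1 + σ + Q * (u1 + τ) ^ 2)
    (h5 : θ 5 = l0 + t2 + σ + Q * (u2 + τ) ^ 2) : InCone θ := by
  rw [square_eq θ h0 h1 h2 h3 h4 h5]
  exact ((InCone.smul _ hl0 InCone_one).add (InCone_leafMix ht1 ht2 hσ cs)).add
    (InCone.smul _ hQ ((InCone_leafMix hu1 hu2 hτ cs').mul (InCone_leafMix hu1 hu2 hτ cs')))

/-- The square criterion at the triangle of two stars. -/
theorem InCone_thetaTri_of_square {m m' : ℕ} (a : Fin m → ℝ) (b : Fin m' → ℝ) {l0 t1 t2 σ Q u1 u2 τ : ℝ}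
    (hl0 : 0 ≤ l0) (ht1 : 0 ≤ t1) (ht2 : 0 ≤ t2) (hσ : 0 ≤ σ) (cs : σ ^ 2 ≤ t1 * t2)
    (hQ : 0 ≤ Q) (hu1 : 0 ≤ u1) (hu2 : 0 ≤ u2) (hτ : 0 ≤ τ) (cs' : τ ^ 2 ≤ u1 * u2)
    (h0 : thetaTri (V a) (V b) 0 = l0 + t1 + t2 + 2 * σ + Q * (u1 + u2 + 2 * τ) ^ 2)
    (h1 : thetaTri (V a) (V b) 1 = l0 + 2 * t1 + t2 + 2 * σ + Q * (2 * u1 + u2 + 2 * τ) ^ 2)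
    (h2 : thetaTri (V a) (V b) 2 = l0 + t1 + 2 * t2 + 2 * σ + Q * (u1 + 2 * u2 + 2 * τ) ^ 2)
    (h3 : thetaTri (V a) (V b) 3 = l0 + σ + Q * τ ^ 2)
    (h4 : thetaTri (V a) (V b) 4 = l0 + t1 + σ + Q * (u1 + τ) ^ 2)
    (h5 : thetaTri (V a) (V b) 5 = l0 + t2 + σ + Q * (u2 + τ) ^ 2) : InCone (thetaTri (V a) (V b)) :=
  InCone_of_square _ hl0 ht1 ht2 hσ cs hQ hu1 hu2 hτ cs' h0 h1 h2 h3 h4 h5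

/-! ## The atom criterion -/

/-- A finite sum of cone elements is a cone element. -/
theorem InCone_sum {n : ℕ} {f : Fin n → Vec6} (h : ∀ i, InCone (f i)) : InCone (∑ i, f i) := by
  refine Finset.sum_induction f InCone (fun x y hx hy => hx.add hy) ?_ (fun i _ => h i)
  have := InCone.smul (0 : ℝ) le_rfl InCone_one
  simpa using this

/-- A product of two leaves at atoms in `[0, 1]` is a cone element. -/
theorem InCone_v_mul_v {s t : ℝ} (hs : 0 ≤ s ∧ s ≤ 1) (ht : 0 ≤ t ∧ t ≤ 1) : InCone (v s * v t) :=
  (InCone_v s hs).mul (InCone_v t ht)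

/-- **THE ATOM CRITERION**: a non-negative combination of `1`, single leaves `v (s i)` and two-leaf products
`v (s' j) * v (t' j)` at atoms in `[0, 1]` is a cone element. -/
theorem InCone_atoms {n₁ n₂ : ℕ} (l0 : ℝ) (hl0 : 0 ≤ l0)
    (μ s : Fin n₁ → ℝ) (hμ : ∀ i, 0 ≤ μ i) (hs : ∀ i, 0 ≤ s i ∧ s i ≤ 1)
    (ρ s' t' : Fin n₂ → ℝ) (hρ : ∀ j, 0 ≤ ρ j) (hs' : ∀ j, 0 ≤ s' j ∧ s' j ≤ 1) (ht' : ∀ j, 0 ≤ t' j ∧ t' j ≤ 1) :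
    InCone (l0 • (1 : Vec6) + ∑ i, μ i • v (s i) + ∑ j, ρ j • (v (s' j) * v (t' j))) :=
  ((InCone.smul _ hl0 InCone_one).add (InCone_sum fun i => (InCone_v _ (hs i)).smul _ (hμ i))).add
    (InCone_sum fun j => (InCone_v_mul_v (hs' j) (ht' j)).smul _ (hρ j))

/-! ## The K₂⁺-transfer of the leaf map -/

/-- The triangle map vanishes at `0` in its second argument. -/
theorem thetaTri_zero_right (w : Vec6) : thetaTri w 0 = 0 := by
  have := thetaTri_smul_right 0 w 0
  simpa using this

/-- The triangle map is additive over finite sums in its second argument. -/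
theorem thetaTri_sum_right {ι : Type*} (s : Finset ι) (w : Vec6) (f : ι → Vec6) :
    thetaTri w (∑ i ∈ s, f i) = ∑ i ∈ s, thetaTri w (f i) := by
  classical
  induction s using Finset.induction_on with
  | empty => simp [thetaTri_zero_right]
  | insert j s hj ih => rw [Finset.sum_insert hj, Finset.sum_insert hj, thetaTri_add_right, ih]

/-- **THE K₂⁺-TRANSFER OF THE LEAF MAP**: `θ_△(v c, w′) ∈ cone` for every `w′` in the explicit cone generated by `1`,
the single leaves, the two-leaf products and the marked vertices `X(p, q) = v 1 ^ p * v 0 ^ q`. -/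
theorem InCone_thetaTri_leaf_K2plus (c : ℝ) (hc : 0 ≤ c ∧ c ≤ 1) {n₁ n₂ n₃ : ℕ}
    (l0 : ℝ) (hl0 : 0 ≤ l0)
    (μ s : Fin n₁ → ℝ) (hμ : ∀ i, 0 ≤ μ i) (hs : ∀ i, 0 ≤ s i ∧ s i ≤ 1)
    (ρ s' t' : Fin n₂ → ℝ) (hρ : ∀ j, 0 ≤ ρ j) (hs' : ∀ j, 0 ≤ s' j ∧ s' j ≤ 1) (ht' : ∀ j, 0 ≤ t' j ∧ t' j ≤ 1)
    (ν : Fin n₃ → ℝ) (p q : Fin n₃ → ℕ) (hν : ∀ k, 0 ≤ ν k) :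
    InCone (thetaTri (v c) (l0 • (1 : Vec6) + ∑ i, μ i • v (s i) + ∑ j, ρ j • (v (s' j) * v (t' j))
      + ∑ k, ν k • (v 1 ^ p k * v 0 ^ q k))) := by
  have hvc : InCone (v c) := InCone_v c hc
  rw [thetaTri_add_right, thetaTri_add_right, thetaTri_add_right, thetaTri_sum_right, thetaTri_sum_right,
    thetaTri_sum_right, thetaTri_smul_right]
  refine (((InCone.smul _ hl0 ?_).add ?_).add ?_).add ?_
  · have := InCone_thetaTri_any_marks' 0 0 hvc
    simpa using this
  · refine InCone_sum fun i => ?_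
    rw [thetaTri_smul_right]
    exact (thetaTri_v_InCone c (s i) hc (hs i)).smul _ (hμ i)
  · refine InCone_sum fun j => ?_
    rw [thetaTri_smul_right]
    exact (InCone_thetaTri_leaf_star2 (s' j) (t' j) c (hs' j) (ht' j) hc).smul _ (hρ j)
  · refine InCone_sum fun k => ?_
    rw [thetaTri_smul_right]
    exact (InCone_thetaTri_any_marks' (p k) (q k) hvc).smul _ (hν k)

/-- `H` at a leaf against a star that lies in `K₂⁺`: the transfer applied to an explicit decomposition of `V b`. -/
theorem InCone_thetaTri_leaf_of_K2plus (c : ℝ) (hc : 0 ≤ c ∧ c ≤ 1) {m : ℕ} (b : Fin m → ℝ) {n₁ n₂ n₃ : ℕ}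
    (l0 : ℝ) (hl0 : 0 ≤ l0)
    (μ s : Fin n₁ → ℝ) (hμ : ∀ i, 0 ≤ μ i) (hs : ∀ i, 0 ≤ s i ∧ s i ≤ 1)
    (ρ s' t' : Fin n₂ → ℝ) (hρ : ∀ j, 0 ≤ ρ j) (hs' : ∀ j, 0 ≤ s' j ∧ s' j ≤ 1) (ht' : ∀ j, 0 ≤ t' j ∧ t' j ≤ 1)
    (ν : Fin n₃ → ℝ) (p q : Fin n₃ → ℕ) (hν : ∀ k, 0 ≤ ν k)
    (hb : V b = l0 • (1 : Vec6) + ∑ i, μ i • v (s i) + ∑ j, ρ j • (v (s' j) * v (t' j))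
      + ∑ k, ν k • (v 1 ^ p k * v 0 ^ q k)) :
    InCone (thetaTri (v c) (V b)) := by
  rw [hb]
  exact InCone_thetaTri_leaf_K2plus c hc l0 hl0 μ s hμ hs ρ s' t' hρ hs' ht' ν p q hν

/-- The mirror: a `K₂⁺` element at the first exit, a leaf at the second. -/
theorem InCone_thetaTri_K2plus_leaf (c : ℝ) (hc : 0 ≤ c ∧ c ≤ 1) {n₁ n₂ n₃ : ℕ}
    (l0 : ℝ) (hl0 : 0 ≤ l0)
    (μ s : Fin n₁ → ℝ) (hμ : ∀ i, 0 ≤ μ i) (hs : ∀ i, 0 ≤ s i ∧ s i ≤ 1)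
    (ρ s' t' : Fin n₂ → ℝ) (hρ : ∀ j, 0 ≤ ρ j) (hs' : ∀ j, 0 ≤ s' j ∧ s' j ≤ 1) (ht' : ∀ j, 0 ≤ t' j ∧ t' j ≤ 1)
    (ν : Fin n₃ → ℝ) (p q : Fin n₃ → ℕ) (hν : ∀ k, 0 ≤ ν k) :
    InCone (thetaTri (l0 • (1 : Vec6) + ∑ i, μ i • v (s i) + ∑ j, ρ j • (v (s' j) * v (t' j))
      + ∑ k, ν k • (v 1 ^ p k * v 0 ^ q k)) (v c)) := by
  rw [thetaTri_comm]
  exact InCone_thetaTri_leaf_K2plus c hc l0 hl0 μ s hμ hs ρ s' t' hρ hs' ht' ν p q hν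

end RelaxedTriangle

end PercRepro
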